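import Summits.BirchSwinnertonDyer.Rank1Residual.X4.KolyvaginIndexRecordsKitOddPrime
import HarnessLib

/-!
# BSD rank-≤1 residual cell, lane class X11b (`p ∥ N`: MULTIPLICATIVE at a prime `p ≥ 5`, `ρ̄_{E,p}` irreducible),
rank ONE: `BSD(E,p)` PER PAIR from
# PUBLISHED theorems + Kolyvagin's HEEGNER-INDEX certificate (two engines), `ρ̄_{E,p}` onto IN THE KERNEL — records 69

HONEST FRAMING (cell `b2b-bsdres-*`, verbatim): prove what is provable now; shrink each hard class to its core with
data; no claim beyond stated classes; COMBINATION classes deleted from PUBLISHED theorems only, CONSTRUCTION-shaped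
remainder typed; this is not "finishing BSD". X11b stays CONSTRUCTION-SHAPED; everything here is PER PAIR; no lane
verdict is changed; no named fact is introduced (debt 0); nothing is booked by this unit (the rung-K2 owner
bsd-stepL, the x11b
lineage that holds row B9's E1/K2 claim, census-lead, the Kurihara lane and referee A decide what a record is
worth); Cremona's numbers
(`r_an = 1`, `#Ш_an`, models, generators, `∏ c_ℓ`, torsion, optimality / Manin codes, the galrep datum) are INPUTS.

Unit `b2b-bsdres-x11c`, GEN 32 (prover-b2b-bsdres-x11c-g32-0) — the «X11 beyond 3» half of the unit's D-0075 purpose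
(«GRH-free
Kolyvagin–Heegner-index certificates X4 r1 p ≥ 7, X11 beyond 3»): the cell's certificate engines turned on lane
class X11b as GEN 27–31 turned
them on X7 (`Supersingular/KolyvaginIndexRecordsX7RankOne01–432`). POPULATION
(`HOME/b2b-bsdres-x11c/gen32/pop/build_harvest_x11b.py` = gen 27's
class-agnostic census restricted to X11b with a per-(label, p) record test): the rank-ONE classes (Cremona curve 1,
non-CM) whose cell
`(p, X11b)` — `p ≥ 5`, `p ∥ N` — is OPEN on the Kurihara lane's residue of record (bsdN sweep v4u `RESIDUE.jsonl` ×
v5u verdict `residue`; on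
848 of them the lane's own tail is T-KOLY, whose single certified Heegner field excludes the primes dividing
`m·D_K`) and which are
certificate-shaped on Cremona's data — no galrep code at `p` (`ρ̄_{E,p}` onto), `p ∤ #E(ℚ)_tors·∏ c_ℓ` (so
`p ∤ c_p = ord_p Δ` at a split
`p`), `p ∤ #Ш_an` — and carry no Kolyvagin-index record `bsdp_k<label>_<p>`: 927 pairs on 869 classes (`p = 5`: 605,
`7`: 221, `11`: 41,
`13`: 20, `17 ≤ p ≤ 103`: 40; split 411 / non-split 516; 268 semistable; `1.6·10⁴ < N < 5·10⁵`). 920 of them ALSO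
carry the unit's GEN 10
beyond-window DATA record (`X11b/BeyondWindowRecordsNN`: Skinner 2016 Thm. A ∘ Stein–Wuthrich 2013 `p`-adic road,
binders as displayed there)
— for those this file is a SECOND, GRH-free and main-conjecture-free road; 7 carry no per-pair record. Not in reach
of this route (numbers, not
a verdict): the lane's 3 062 Tamagawa-obstructed X11b rank-one cells at `p ≥ 5` (`p ∣ c_q` for some `q`; Jetchev
2008's Hypothesis (∗)
`p ∤ N` fails at `p ∥ N`). THIS FILE (records 69): 10 pairs — `294840h1@7`, `295260d1@7`, `298452j1@7`,
`300300bg1@7`, `303030bo1@7`, `303450dh1@7`, `304850be1@7`, `309960t1@7`, `310590a1@7`, `310590cc1@7`. 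

THE ROUTE (the unit's GEN 26/27 Kolyvagin route, class-agnostic): Kolyvagin's theorem as PRINTED by McCallum (LMS LN
153 (1991) §1, p. 296) /
Gross (ibid., Prop. 2.1 (2)) — tree named facts `kolyvagin`, `Kolyvagin1990_padicValNat_card_sha_le`, whose printed
hypotheses are `y_K` of
infinite order, `p` odd, `ρ̄_{E,p}` onto, and NOTHING about the reduction of `E` at `p` (at `p ∥ N` the Heegner
hypothesis — every prime of
`N` split in `K` — makes `p` split in `K`; nothing more is asked) —: `ord_p #Ш(E/K) ≤ 2·ord_p [E(K):ℤy_K]`; so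
`p ∤ [E(K):ℤy_K]` gives
`Ш(E/K)[p] = 0`, hence `Ш(E/ℚ)[p] = 0`, and with `ord_p #Ш_an = 0` Miller's `BSD(E,p)` — the tree's class-agnostic
consumer
`Typed.bsdp_of_kolyvagin_of_not_dvd_index` (`Literature/…/Rank1Residual/Typed/KolyvaginCertificate.lean`).

THE CERTIFICATE (per pair; the cell's EXISTING engines run VERBATIM — no private engine, no knob; ONE batched kit
job per stage with an
in-job fan-out wrapper): engine 1 = gen 3's `engine1_cha1b/main.py` = x9-g7 `jobD1b.py` (cypari2, sha256
`69e29ec7…`; rank-one mode: Heegner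
fields `K = ℚ(√D)`, `D < -4` fundamental, every prime of `N` split, `p ∤ D`, increasing `|D| ≤ 6000`, `≤ 30` fields;
root number of `E^D`
`+1`, rank-`≥ 2` twists skipped; `hy = L'(E,1)·L(E^D,1)·√|D|/(4·Area(E))`, `ρ = hy/ĥ(x)`, `m = √(4ρ)` an integer,
CERT iff `p ∤ m` —
Miller 2011 Thm. 4.1 / Cor. 4.8); engine 2 = gen 3's `engine2/run_cert.py` (`1b54bb20…`) + `e2lib.py` (`6701e05d…`)
+ `tate_stdlib.py`
(`ed9e5fd9…`) (stdlib python: independent `L`-series, AGM periods, Tate heights; `m`, `ord_p m` must be EQUAL;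
discrete checks — model,
conductor, Tamagawa, non-CM, irreducibility / saturation / `E(K)[p] = 0` witnesses, `D` Heegner); twist values =
additive-p1's
`twistvals/main.py` (`e501b988…`). Kit jobs: j259809, j260660, j260662, j260666, j260667. Evidence:
`HOME/b2b-bsdres-x11c/gen32/` (`KOLY-X11BR1-TABLE.md`, outputs, inputs,
SHA256SUMS); REPORT.md §41.

KERNEL (per pair, through the unit's kit theorem `X4.bsdp_prime_of_kolyvaginIndex_of_serreCounts` of
`X4/KolyvaginIndexRecordsKitOddPrime.lean` — class-agnostic despite its namespace —, every numeric hypothesis a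
`decide` goal): `Δ ≠ 0`;
global minimality of Cremona's model (bounded Kraus criterion); `ρ̄_{E,p}` ONTO by Serre's Prop. 19 from three
witness primes
`(ℓ₁, ℓ₂, ℓ₃)` (types s₁ split / s₂ non-split / s₃ `u = a²/ℓ ∉ {0,1,2,4}`, `u² − 3u + 1 ≢ 0`) whose point counts
`#Ẽ(𝔽_ℓ)` (schema
`countPoints`) are evaluated in the kernel. BINDERS (displayed in every theorem): `hGZK` (Gross–Zagier–Kolyvagin),
`hKo` / `hB` (Kolyvagin
as printed), the Heegner datum (`K`, level `N`, `P`, `p ∤ [E(K):ℤP]`), `r_an ≤ 1`, `#Ш_an = q` with `ord_p q = 0`.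
NOT rechecked in the
kernel (engine work): `L'(E,1)`, `L(E^D,1)`, periods, heights, saturation, the integrality of `4ρ`; nor the lane's
class bit (`p ∥ N`,
split / non-split — bookkeeping only, the route does not use it). What a record is worth is the owners' / lane's /
referee's call
(EVIDENCE-grade certificate under displayed binders, as every Heegner-index record of the cell).

References: McCallum 1991 §1 [McCallumLMS1991]; Gross 1991 Prop. 2.1 [GrossLMS1991]; Kolyvagin 1990
[KolyvaginEulerSystems1990]; Serre 1972 §2.8 Prop. 19 [Serre1972]; Miller 2011 Def. 1.1, Thm. 4.1, Cor. 4.8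
[Miller2011LMS];
Silverman AEC VII.1, VIII.8 [SilvermanAEC2009]; Cremona's tables [Cremona2006].
-/

set_option autoImplicit false

noncomputable section

open scoped Classical

open WeierstrassCurve Literature.NumberTheory.EllipticCurves
  Literature.NumberTheory.EllipticCurves.Rank1Residual
  Literature.NumberTheory.EllipticCurves.Rank1Residual.Typed
  Literature.NumberTheory.EllipticCurves.Rank1Residual.X11RankOneCertificates
  Summit.BirchSwinnertonDyer.BirchSwinnertonDyer.Rank1Residual.IntModel
  Summit.BirchSwinnertonDyer.BirchSwinnertonDyer.Rank1Residual.X11RankOne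
  Summit.BirchSwinnertonDyer.Rank1Residual.X4

namespace Summit.BirchSwinnertonDyer.Rank1Residual.X11b

/-- **`BSD(E,7)` for `294840h1`** (`N = 294840 = 2³·3⁴·5·7·13`; NON-SPLIT MULTIPLICATIVE at `7` (Kodaira `I7`, `c_7 = 1`, additive at `2`, `3`);
`#tors = 1`, `∏c = 4`, `r_an = 1`, `#Ш_an = 1`, generator `(448, 7046)`; lane residue cell `(7, X11b)` (bsdN v4u/v5u of record: `residue:X11b`, lane
tail T-KOLY); ALSO the unit's GEN 10 beyond-window DATA record in `X11b/BeyondWindowRecords36.lean` (Skinner 2016 Thm. A ∘ Stein–Wuthrich 2013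
`p`-adic road, binders as displayed there) — this row is a SECOND road). `D = -1559` (1559 prime): **`m = [E(K):ℤy_K] = 48`, `7 ∤ m`**
(`ρ = 576.00…`; `L'(E,1) = 7.30335354…`, `L(E^D,1) = 0.91424415…`, `ĥ(x) = 4.06461066…`) — engine 1 (j259809) = engine 2 (j260666; EQUAL, dev. ≤
2.6·10⁻¹⁴, checks true); twist `E^D` (j260667): `#tors·∏c·#Ш_an = 1·8·36`, prime to `7` — BSD-consistent. Witnesses mod `7` `(ℓ,#Ẽ(𝔽_ℓ))` =
`(19,26)` (`a = -6`, `a² − 4ℓ ≡ 2` square), `(11,11)` (`a = 1`, `a² − 4ℓ ≡ 6` non-square), `(17,16)` (`u ≡ 6`).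
[cite: McCallumLMS1991, §1 Theorem (Kolyvagin), p. 296] [cite: Serre1972, §2.8 Prop. 19] [cite: Cremona2006, Table 1 (label 294840h1)] -/
theorem bsdp_k294840h1_7 (hGZK : rank_eq_analyticRank_of_analyticRank_le_one) (W : WeierstrassCurve ℚ)
    (hW : W = ⟨0, 0, 0, -131148, 18485028⟩) {N : ℕ} [NeZero N] {K : Type} [Field K] [NumberField K]
    (hKo : kolyvagin N W K) (hB : Kolyvagin1990_padicValNat_card_sha_le N W K) (hK : IsImaginaryQuadratic K)
    (hH : SatisfiesHeegnerHypothesis N K) {P : (W.baseChange K).toAffine.Point} (hP : IsHeegnerPoint N W K P)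
    (hnt : ¬ IsOfFinAddOrder P) (hI : ¬ 7 ∣ (AddSubgroup.zmultiples P).index) (hr : W.analyticRank ≤ 1)
    {q : ℚ} (hq : shaAn W = (q : ℂ)) (hv : padicValRat 7 q = 0) : BSDp W 7 :=
  bsdp_prime_of_kolyvaginIndex_of_serreCounts 7 (by norm_num) (by norm_num) 0 0 0 (-131148) 18485028 (by decide +kernel)
    (by decide +kernel) (by decide +kernel) 19 11 17 (by norm_num) (by norm_num) (by norm_num) (by norm_num)
    (by norm_num) (by norm_num) (by norm_num) (by norm_num) (by norm_num) (by decide +kernel) (by decide +kernel)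
    (by decide +kernel) (n₁ := 26) (n₂ := 11) (n₃ := 16) (hc₁ := by decide +kernel) (hc₂ := by decide +kernel)
    (hc₃ := by decide +kernel) (by decide +kernel) (by decide +kernel) (by decide +kernel) hGZK W
    (by rw [hW]; norm_num) hKo hB hK hH hP hnt hI hr hq hv

/-- **`BSD(E,7)` for `295260d1`** (`N = 295260 = 2²·3·5·7·19·37`; SPLIT MULTIPLICATIVE at `7` (Kodaira `I2`, `c_7 = 2`, additive at `2`); `#tors = 1`,
`∏c = 20`, `r_an = 1`, `#Ш_an = 1`, generator `(-216, 4617)`; lane residue cell `(7, X11b)` (bsdN v4u/v5u of record: `residue:X11b`, lane tail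
T-KOLY); ALSO the unit's GEN 10 beyond-window DATA record in `X11b/BeyondWindowRecords36.lean` (Skinner 2016 Thm. A ∘ Stein–Wuthrich 2013 `p`-adic
road, binders as displayed there) — this row is a SECOND road). `D = -1991` (1991 = 11·181): **`m = [E(K):ℤy_K] = 40`, `7 ∤ m`** (`ρ = 399.99…`;
`L'(E,1) = 5.62248986…`, `L(E^D,1) = 0.12273426…`, `ĥ(x) = 1.14473863…`) — engine 1 (j259809) = engine 2 (j260660; EQUAL, dev. ≤ 7.1·10⁻¹⁴, checks
true); twist `E^D` (j260667): `#tors·∏c·#Ш_an = 1·40·1`, prime to `7` — BSD-consistent. Witnesses mod `7` `(ℓ,#Ẽ(𝔽_ℓ))` = `(11,17)` (`a = -5`,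
`a² − 4ℓ ≡ 2` square), `(13,8)` (`a = 6`, `a² − 4ℓ ≡ 5` non-square), `(13,8)` (`u ≡ 6`).
[cite: McCallumLMS1991, §1 Theorem (Kolyvagin), p. 296] [cite: Serre1972, §2.8 Prop. 19] [cite: Cremona2006, Table 1 (label 295260d1)] -/
theorem bsdp_k295260d1_7 (hGZK : rank_eq_analyticRank_of_analyticRank_le_one) (W : WeierstrassCurve ℚ)
    (hW : W = ⟨0, -1, 0, -15741, 28040985⟩) {N : ℕ} [NeZero N] {K : Type} [Field K] [NumberField K]
    (hKo : kolyvagin N W K) (hB : Kolyvagin1990_padicValNat_card_sha_le N W K) (hK : IsImaginaryQuadratic K)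
    (hH : SatisfiesHeegnerHypothesis N K) {P : (W.baseChange K).toAffine.Point} (hP : IsHeegnerPoint N W K P)
    (hnt : ¬ IsOfFinAddOrder P) (hI : ¬ 7 ∣ (AddSubgroup.zmultiples P).index) (hr : W.analyticRank ≤ 1)
    {q : ℚ} (hq : shaAn W = (q : ℂ)) (hv : padicValRat 7 q = 0) : BSDp W 7 :=
  bsdp_prime_of_kolyvaginIndex_of_serreCounts 7 (by norm_num) (by norm_num) 0 (-1) 0 (-15741) 28040985 (by decide +kernel)
    (by decide +kernel) (by decide +kernel) 11 13 13 (by norm_num) (by norm_num) (by norm_num) (by norm_num)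
    (by norm_num) (by norm_num) (by norm_num) (by norm_num) (by norm_num) (by decide +kernel) (by decide +kernel)
    (by decide +kernel) (n₁ := 17) (n₂ := 8) (n₃ := 8) (hc₁ := by decide +kernel) (hc₂ := by decide +kernel)
    (hc₃ := by decide +kernel) (by decide +kernel) (by decide +kernel) (by decide +kernel) hGZK W
    (by rw [hW]; norm_num) hKo hB hK hH hP hnt hI hr hq hv

/-- **`BSD(E,7)` for `298452j1`** (`N = 298452 = 2²·3·7·11·17·19`; NON-SPLIT MULTIPLICATIVE at `7` (Kodaira `I9`, `c_7 = 1`, additive at `2`);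
`#tors = 1`, `∏c = 12`, `r_an = 1`, `#Ш_an = 1`, generator `(141, 2142)`; lane residue cell `(7, X11b)` (bsdN v4u/v5u of record: `residue:X11b`,
lane tail T-KOLY); ALSO the unit's GEN 10 beyond-window DATA record in `X11b/BeyondWindowRecords36.lean` (Skinner 2016 Thm. A ∘ Stein–Wuthrich 2013
`p`-adic road, binders as displayed there) — this row is a SECOND road). `D = -1823` (1823 prime): **`m = [E(K):ℤy_K] = 72`, `7 ∤ m`**
(`ρ = 1295.99…`; `L'(E,1) = 10.02320040…`, `L(E^D,1) = 0.54157018…`, `ĥ(x) = 3.05339505…`) — engine 1 (j259809) = engine 2 (j260662; EQUAL, dev. ≤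
9.1·10⁻¹⁴, checks true); twist `E^D` (j260667): `#tors·∏c·#Ш_an = 1·12·9`, prime to `7` — BSD-consistent. Witnesses mod `7` `(ℓ,#Ẽ(𝔽_ℓ))` = `(5,5)`
(`a = 1`, `a² − 4ℓ ≡ 2` square), `(13,18)` (`a = -4`, `a² − 4ℓ ≡ 6` non-square), `(5,5)` (`u ≡ 3`).
[cite: McCallumLMS1991, §1 Theorem (Kolyvagin), p. 296] [cite: Serre1972, §2.8 Prop. 19] [cite: Cremona2006, Table 1 (label 298452j1)] -/
theorem bsdp_k298452j1_7 (hGZK : rank_eq_analyticRank_of_analyticRank_le_one) (W : WeierstrassCurve ℚ)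
    (hW : W = ⟨0, 1, 0, -266645, 39362007⟩) {N : ℕ} [NeZero N] {K : Type} [Field K] [NumberField K]
    (hKo : kolyvagin N W K) (hB : Kolyvagin1990_padicValNat_card_sha_le N W K) (hK : IsImaginaryQuadratic K)
    (hH : SatisfiesHeegnerHypothesis N K) {P : (W.baseChange K).toAffine.Point} (hP : IsHeegnerPoint N W K P)
    (hnt : ¬ IsOfFinAddOrder P) (hI : ¬ 7 ∣ (AddSubgroup.zmultiples P).index) (hr : W.analyticRank ≤ 1)
    {q : ℚ} (hq : shaAn W = (q : ℂ)) (hv : padicValRat 7 q = 0) : BSDp W 7 :=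
  bsdp_prime_of_kolyvaginIndex_of_serreCounts 7 (by norm_num) (by norm_num) 0 1 0 (-266645) 39362007 (by decide +kernel)
    (by decide +kernel) (by decide +kernel) 5 13 5 (by norm_num) (by norm_num) (by norm_num) (by norm_num)
    (by norm_num) (by norm_num) (by norm_num) (by norm_num) (by norm_num) (by decide +kernel) (by decide +kernel)
    (by decide +kernel) (n₁ := 5) (n₂ := 18) (n₃ := 5) (hc₁ := by decide +kernel) (hc₂ := by decide +kernel)
    (hc₃ := by decide +kernel) (by decide +kernel) (by decide +kernel) (by decide +kernel) hGZK W
    (by rw [hW]; norm_num) hKo hB hK hH hP hnt hI hr hq hv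

/-- **`BSD(E,7)` for `300300bg1`** (`N = 300300 = 2²·3·5²·7·11·13`; SPLIT MULTIPLICATIVE at `7` (Kodaira `I1`, `c_7 = 1`, additive at `2`, `5`);
`#tors = 2`, `∏c = 32`, `r_an = 1`, `#Ш_an = 1`, generator `(1322, 6000)`; lane residue cell `(7, X11b)` (bsdN v4u/v5u of record: `residue:X11b`,
lane tail T-KOLY); ALSO the unit's GEN 10 beyond-window DATA record in `X11b/BeyondWindowRecords37.lean` (Skinner 2016 Thm. A ∘ Stein–Wuthrich 2013
`p`-adic road, binders as displayed there) — this row is a SECOND road). `D = -5711` (5711 prime): **`m = [E(K):ℤy_K] = 64`, `7 ∤ m`**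
(`ρ = 1023.99…`; `L'(E,1) = 5.17537902…`, `L(E^D,1) = 0.17314115…`, `ĥ(x) = 3.30648171…`) — engine 1 (j259809) = engine 2 (j260662; EQUAL, dev. ≤
7.1·10⁻¹⁴, checks true); twist `E^D` (j260667): `#tors·∏c·#Ш_an = 2·64·16`, prime to `7` — BSD-consistent. Witnesses mod `7` `(ℓ,#Ẽ(𝔽_ℓ))` =
`(41,44)` (`a = -2`, `a² − 4ℓ ≡ 1` square), `(17,24)` (`a = -6`, `a² − 4ℓ ≡ 3` non-square), `(17,24)` (`u ≡ 5`).
[cite: McCallumLMS1991, §1 Theorem (Kolyvagin), p. 296] [cite: Serre1972, §2.8 Prop. 19] [cite: Cremona2006, Table 1 (label 300300bg1)] -/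
theorem bsdp_k300300bg1_7 (hGZK : rank_eq_analyticRank_of_analyticRank_le_one) (W : WeierstrassCurve ℚ)
    (hW : W = ⟨0, -1, 0, -4751033, 4008175062⟩) {N : ℕ} [NeZero N] {K : Type} [Field K] [NumberField K]
    (hKo : kolyvagin N W K) (hB : Kolyvagin1990_padicValNat_card_sha_le N W K) (hK : IsImaginaryQuadratic K)
    (hH : SatisfiesHeegnerHypothesis N K) {P : (W.baseChange K).toAffine.Point} (hP : IsHeegnerPoint N W K P)
    (hnt : ¬ IsOfFinAddOrder P) (hI : ¬ 7 ∣ (AddSubgroup.zmultiples P).index) (hr : W.analyticRank ≤ 1)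
    {q : ℚ} (hq : shaAn W = (q : ℂ)) (hv : padicValRat 7 q = 0) : BSDp W 7 :=
  bsdp_prime_of_kolyvaginIndex_of_serreCounts 7 (by norm_num) (by norm_num) 0 (-1) 0 (-4751033) 4008175062 (by decide +kernel)
    (by decide +kernel) (by decide +kernel) 41 17 17 (by norm_num) (by norm_num) (by norm_num) (by norm_num)
    (by norm_num) (by norm_num) (by norm_num) (by norm_num) (by norm_num) (by decide +kernel) (by decide +kernel)
    (by decide +kernel) (n₁ := 44) (n₂ := 24) (n₃ := 24) (hc₁ := by decide +kernel) (hc₂ := by decide +kernel)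
    (hc₃ := by decide +kernel) (by decide +kernel) (by decide +kernel) (by decide +kernel) hGZK W
    (by rw [hW]; norm_num) hKo hB hK hH hP hnt hI hr hq hv

/-- **`BSD(E,7)` for `303030bo1`** (`N = 303030 = 2·3²·5·7·13·37`; SPLIT MULTIPLICATIVE at `7` (Kodaira `I1`, `c_7 = 1`, additive at `3`); `#tors = 2`,
`∏c = 16`, `r_an = 1`, `#Ш_an = 1`, generator `(20128457/1681, 83231846239/68921)`; lane residue cell `(7, X11b)` (bsdN v4u/v5u of record:
`residue:X11b`, lane tail T-KOLY); ALSO the unit's GEN 10 beyond-window DATA record in `X11b/BeyondWindowRecords37.lean` (Skinner 2016 Thm. A ∘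
Stein–Wuthrich 2013 `p`-adic road, binders as displayed there) — this row is a SECOND road). `D = -3839` (3839 = 11·349): **`m = [E(K):ℤy_K] = 64`,
`7 ∤ m`** (`ρ = 1024.00…`; `L'(E,1) = 4.51246498…`, `L(E^D,1) = 0.37014198…`, `ĥ(x) = 15.08957615…`) — engine 1 (j259809) = engine 2 (j260666;
EQUAL, dev. ≤ 7.9·10⁻¹⁶, checks true); twist `E^D` (j260667): `#tors·∏c·#Ш_an = 2·64·16`, prime to `7` — BSD-consistent. Witnesses mod `7`
`(ℓ,#Ẽ(𝔽_ℓ))` = `(23,28)` (`a = -4`, `a² − 4ℓ ≡ 1` square), `(11,18)` (`a = -6`, `a² − 4ℓ ≡ 6` non-square), `(17,24)` (`u ≡ 5`).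
[cite: McCallumLMS1991, §1 Theorem (Kolyvagin), p. 296] [cite: Serre1972, §2.8 Prop. 19] [cite: Cremona2006, Table 1 (label 303030bo1)] -/
theorem bsdp_k303030bo1_7 (hGZK : rank_eq_analyticRank_of_analyticRank_le_one) (W : WeierstrassCurve ℚ)
    (hW : W = ⟨1, -1, 0, -18784584, -18904286912⟩) {N : ℕ} [NeZero N] {K : Type} [Field K] [NumberField K]
    (hKo : kolyvagin N W K) (hB : Kolyvagin1990_padicValNat_card_sha_le N W K) (hK : IsImaginaryQuadratic K)
    (hH : SatisfiesHeegnerHypothesis N K) {P : (W.baseChange K).toAffine.Point} (hP : IsHeegnerPoint N W K P)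
    (hnt : ¬ IsOfFinAddOrder P) (hI : ¬ 7 ∣ (AddSubgroup.zmultiples P).index) (hr : W.analyticRank ≤ 1)
    {q : ℚ} (hq : shaAn W = (q : ℂ)) (hv : padicValRat 7 q = 0) : BSDp W 7 :=
  bsdp_prime_of_kolyvaginIndex_of_serreCounts 7 (by norm_num) (by norm_num) 1 (-1) 0 (-18784584) (-18904286912) (by decide +kernel)
    (by decide +kernel) (by decide +kernel) 23 11 17 (by norm_num) (by norm_num) (by norm_num) (by norm_num)
    (by norm_num) (by norm_num) (by norm_num) (by norm_num) (by norm_num) (by decide +kernel) (by decide +kernel)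
    (by decide +kernel) (n₁ := 28) (n₂ := 18) (n₃ := 24) (hc₁ := by decide +kernel) (hc₂ := by decide +kernel)
    (hc₃ := by decide +kernel) (by decide +kernel) (by decide +kernel) (by decide +kernel) hGZK W
    (by rw [hW]; norm_num) hKo hB hK hH hP hnt hI hr hq hv

/-- **`BSD(E,7)` for `303450dh1`** (`N = 303450 = 2·3·5²·7·17²`; SPLIT MULTIPLICATIVE at `7` (Kodaira `I1`, `c_7 = 1`, additive at `5`, `17`);
`#tors = 1`, `∏c = 24`, `r_an = 1`, `#Ш_an = 1`, generator `(1312, 9431)`; lane residue cell `(7, X11b)` (bsdN v4u/v5u of record: `residue:X11b,X2`,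
lane tail T-KOLY, other open cells `(3, X2)`); ALSO the unit's GEN 10 beyond-window DATA record in `X11b/BeyondWindowRecords37.lean` (Skinner 2016
Thm. A ∘ Stein–Wuthrich 2013 `p`-adic road, binders as displayed there) — this row is a SECOND road). `D = -1679` (1679 = 23·73):
**`m = [E(K):ℤy_K] = 48`, `7 ∤ m`** (`ρ = 576.00…`; `L'(E,1) = 8.07816616…`, `L(E^D,1) = 0.13807584…`, `ĥ(x) = 4.97304163…`) — engine 1 (j259809) =
engine 2 (j260666; EQUAL, dev. ≤ 2.9·10⁻¹⁴, checks true); twist `E^D` (j260667): `#tors·∏c·#Ш_an = 1·48·1`, prime to `7` — BSD-consistent. Witnesses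
mod `7` `(ℓ,#Ẽ(𝔽_ℓ))` = `(41,51)` (`a = -9`, `a² − 4ℓ ≡ 1` square), `(13,13)` (`a = 1`, `a² − 4ℓ ≡ 5` non-square), `(13,13)` (`u ≡ 6`).
[cite: McCallumLMS1991, §1 Theorem (Kolyvagin), p. 296] [cite: Serre1972, §2.8 Prop. 19] [cite: Cremona2006, Table 1 (label 303450dh1)] -/
theorem bsdp_k303450dh1_7 (hGZK : rank_eq_analyticRank_of_analyticRank_le_one) (W : WeierstrassCurve ℚ)
    (hW : W = ⟨1, 0, 1, -43501, -2100003352⟩) {N : ℕ} [NeZero N] {K : Type} [Field K] [NumberField K]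
    (hKo : kolyvagin N W K) (hB : Kolyvagin1990_padicValNat_card_sha_le N W K) (hK : IsImaginaryQuadratic K)
    (hH : SatisfiesHeegnerHypothesis N K) {P : (W.baseChange K).toAffine.Point} (hP : IsHeegnerPoint N W K P)
    (hnt : ¬ IsOfFinAddOrder P) (hI : ¬ 7 ∣ (AddSubgroup.zmultiples P).index) (hr : W.analyticRank ≤ 1)
    {q : ℚ} (hq : shaAn W = (q : ℂ)) (hv : padicValRat 7 q = 0) : BSDp W 7 :=
  bsdp_prime_of_kolyvaginIndex_of_serreCounts 7 (by norm_num) (by norm_num) 1 0 1 (-43501) (-2100003352) (by decide +kernel)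
    (by decide +kernel) (by decide +kernel) 41 13 13 (by norm_num) (by norm_num) (by norm_num) (by norm_num)
    (by norm_num) (by norm_num) (by norm_num) (by norm_num) (by norm_num) (by decide +kernel) (by decide +kernel)
    (by decide +kernel) (n₁ := 51) (n₂ := 13) (n₃ := 13) (hc₁ := by decide +kernel) (hc₂ := by decide +kernel)
    (hc₃ := by decide +kernel) (by decide +kernel) (by decide +kernel) (by decide +kernel) hGZK W
    (by rw [hW]; norm_num) hKo hB hK hH hP hnt hI hr hq hv

/-- **`BSD(E,7)` for `304850be1`** (`N = 304850 = 2·5²·7·13·67`; NON-SPLIT MULTIPLICATIVE at `7` (Kodaira `I1`, `c_7 = 1`, additive at `5`);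
`#tors = 1`, `∏c = 40`, `r_an = 1`, `#Ш_an = 1`, generator `(312, 4069)`; lane residue cell `(7, X11b)` (bsdN v4u/v5u of record: `residue:X11b`,
lane tail T-KOLY); ALSO the unit's GEN 10 beyond-window DATA record in `X11b/BeyondWindowRecords37.lean` (Skinner 2016 Thm. A ∘ Stein–Wuthrich 2013
`p`-adic road, binders as displayed there) — this row is a SECOND road). `D = -1559` (1559 prime): **`m = [E(K):ℤy_K] = 320`, `7 ∤ m`**
(`ρ = 25600.00…`; `L'(E,1) = 10.57724548…`, `L(E^D,1) = 4.53460587…`, `ĥ(x) = 0.75892162…`) — engine 1 (j259809) = engine 2 (j260666; EQUAL, dev. ≤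
1.1·10⁻¹³, checks true); twist `E^D` (j260667): `#tors·∏c·#Ш_an = 1·80·16`, prime to `7` — BSD-consistent. Witnesses mod `7` `(ℓ,#Ẽ(𝔽_ℓ))` =
`(17,14)` (`a = 4`, `a² − 4ℓ ≡ 4` square), `(3,6)` (`a = -2`, `a² − 4ℓ ≡ 6` non-square), `(3,6)` (`u ≡ 6`).
[cite: McCallumLMS1991, §1 Theorem (Kolyvagin), p. 296] [cite: Serre1972, §2.8 Prop. 19] [cite: Cremona2006, Table 1 (label 304850be1)] -/
theorem bsdp_k304850be1_7 (hGZK : rank_eq_analyticRank_of_analyticRank_le_one) (W : WeierstrassCurve ℚ)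
    (hW : W = ⟨1, 0, 0, -76713, 11389417⟩) {N : ℕ} [NeZero N] {K : Type} [Field K] [NumberField K]
    (hKo : kolyvagin N W K) (hB : Kolyvagin1990_padicValNat_card_sha_le N W K) (hK : IsImaginaryQuadratic K)
    (hH : SatisfiesHeegnerHypothesis N K) {P : (W.baseChange K).toAffine.Point} (hP : IsHeegnerPoint N W K P)
    (hnt : ¬ IsOfFinAddOrder P) (hI : ¬ 7 ∣ (AddSubgroup.zmultiples P).index) (hr : W.analyticRank ≤ 1)
    {q : ℚ} (hq : shaAn W = (q : ℂ)) (hv : padicValRat 7 q = 0) : BSDp W 7 :=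
  bsdp_prime_of_kolyvaginIndex_of_serreCounts 7 (by norm_num) (by norm_num) 1 0 0 (-76713) 11389417 (by decide +kernel)
    (by decide +kernel) (by decide +kernel) 17 3 3 (by norm_num) (by norm_num) (by norm_num) (by norm_num)
    (by norm_num) (by norm_num) (by norm_num) (by norm_num) (by norm_num) (by decide +kernel) (by decide +kernel)
    (by decide +kernel) (n₁ := 14) (n₂ := 6) (n₃ := 6) (hc₁ := by decide +kernel) (hc₂ := by decide +kernel)
    (hc₃ := by decide +kernel) (by decide +kernel) (by decide +kernel) (by decide +kernel) hGZK W
    (by rw [hW]; norm_num) hKo hB hK hH hP hnt hI hr hq hv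

/-- **`BSD(E,7)` for `309960t1`** (`N = 309960 = 2³·3³·5·7·41`; SPLIT MULTIPLICATIVE at `7` (Kodaira `I1`, `c_7 = 1`, additive at `2`, `3`);
`#tors = 1`, `∏c = 8`, `r_an = 1`, `#Ш_an = 1`, generator `(-4, 10)`; lane residue cell `(7, X11b)` (bsdN v4u/v5u of record: `residue:X11b`, lane
tail T-KOLY); ALSO the unit's GEN 10 beyond-window DATA record in `X11b/BeyondWindowRecords38.lean` (Skinner 2016 Thm. A ∘ Stein–Wuthrich 2013
`p`-adic road, binders as displayed there) — this row is a SECOND road). `D = -1679` (1679 = 23·73): **`m = [E(K):ℤy_K] = 32`, `7 ∤ m`**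
(`ρ = 256.00…`; `L'(E,1) = 9.49186448…`, `L(E^D,1) = 1.43637572…`, `ĥ(x) = 0.77824265…`) — engine 1 (j259809) = engine 2 (j260660; EQUAL, dev. ≤
1.3·10⁻¹⁴, checks true); twist `E^D` (j260667): `#tors·∏c·#Ш_an = 1·32·1`, prime to `7` — BSD-consistent. Witnesses mod `7` `(ℓ,#Ẽ(𝔽_ℓ))` = `(11,7)`
(`a = 5`, `a² − 4ℓ ≡ 2` square), `(19,15)` (`a = 5`, `a² − 4ℓ ≡ 5` non-square), `(13,9)` (`u ≡ 3`).
[cite: McCallumLMS1991, §1 Theorem (Kolyvagin), p. 296] [cite: Serre1972, §2.8 Prop. 19] [cite: Cremona2006, Table 1 (label 309960t1)] -/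
theorem bsdp_k309960t1_7 (hGZK : rank_eq_analyticRank_of_analyticRank_le_one) (W : WeierstrassCurve ℚ)
    (hW : W = ⟨0, 0, 0, -108, -268⟩) {N : ℕ} [NeZero N] {K : Type} [Field K] [NumberField K]
    (hKo : kolyvagin N W K) (hB : Kolyvagin1990_padicValNat_card_sha_le N W K) (hK : IsImaginaryQuadratic K)
    (hH : SatisfiesHeegnerHypothesis N K) {P : (W.baseChange K).toAffine.Point} (hP : IsHeegnerPoint N W K P)
    (hnt : ¬ IsOfFinAddOrder P) (hI : ¬ 7 ∣ (AddSubgroup.zmultiples P).index) (hr : W.analyticRank ≤ 1)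
    {q : ℚ} (hq : shaAn W = (q : ℂ)) (hv : padicValRat 7 q = 0) : BSDp W 7 :=
  bsdp_prime_of_kolyvaginIndex_of_serreCounts 7 (by norm_num) (by norm_num) 0 0 0 (-108) (-268) (by decide +kernel)
    (by decide +kernel) (by decide +kernel) 11 19 13 (by norm_num) (by norm_num) (by norm_num) (by norm_num)
    (by norm_num) (by norm_num) (by norm_num) (by norm_num) (by norm_num) (by decide +kernel) (by decide +kernel)
    (by decide +kernel) (n₁ := 7) (n₂ := 15) (n₃ := 9) (hc₁ := by decide +kernel) (hc₂ := by decide +kernel)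
    (hc₃ := by decide +kernel) (by decide +kernel) (by decide +kernel) (by decide +kernel) hGZK W
    (by rw [hW]; norm_num) hKo hB hK hH hP hnt hI hr hq hv

/-- **`BSD(E,7)` for `310590a1`** (`N = 310590 = 2·3²·5·7·17·29`; NON-SPLIT MULTIPLICATIVE at `7` (Kodaira `I1`, `c_7 = 1`, additive at `3`);
`#tors = 1`, `∏c = 1`, `r_an = 1`, `#Ш_an = 1`, generator `(13, 93)`; lane residue cell `(7, X11b)` (bsdN v4u/v5u of record: `residue:X11b`, lane
tail T-KOLY); ALSO the unit's GEN 10 beyond-window DATA record in `X11b/BeyondWindowRecords38.lean` (Skinner 2016 Thm. A ∘ Stein–Wuthrich 2013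
`p`-adic road, binders as displayed there) — this row is a SECOND road). `D = -3239` (3239 = 41·79): **`m = [E(K):ℤy_K] = 4`, `7 ∤ m`**
(`ρ = 3.99…`; `L'(E,1) = 3.06301686…`, `L(E^D,1) = 0.04403140…`, `ĥ(x) = 4.04297866…`) — engine 1 (j259809) = engine 2 (j260660; EQUAL, dev. ≤
9.9·10⁻¹⁴, checks true); twist `E^D` (j260667): `#tors·∏c·#Ш_an = 1·4·1`, prime to `7` — BSD-consistent. Witnesses mod `7` `(ℓ,#Ẽ(𝔽_ℓ))` = `(11,17)`
(`a = -5`, `a² − 4ℓ ≡ 2` square), `(13,18)` (`a = -4`, `a² − 4ℓ ≡ 6` non-square), `(13,18)` (`u ≡ 5`).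
[cite: McCallumLMS1991, §1 Theorem (Kolyvagin), p. 296] [cite: Serre1972, §2.8 Prop. 19] [cite: Cremona2006, Table 1 (label 310590a1)] -/
theorem bsdp_k310590a1_7 (hGZK : rank_eq_analyticRank_of_analyticRank_le_one) (W : WeierstrassCurve ℚ)
    (hW : W = ⟨1, -1, 0, -3780, 56970⟩) {N : ℕ} [NeZero N] {K : Type} [Field K] [NumberField K]
    (hKo : kolyvagin N W K) (hB : Kolyvagin1990_padicValNat_card_sha_le N W K) (hK : IsImaginaryQuadratic K)
    (hH : SatisfiesHeegnerHypothesis N K) {P : (W.baseChange K).toAffine.Point} (hP : IsHeegnerPoint N W K P)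
    (hnt : ¬ IsOfFinAddOrder P) (hI : ¬ 7 ∣ (AddSubgroup.zmultiples P).index) (hr : W.analyticRank ≤ 1)
    {q : ℚ} (hq : shaAn W = (q : ℂ)) (hv : padicValRat 7 q = 0) : BSDp W 7 :=
  bsdp_prime_of_kolyvaginIndex_of_serreCounts 7 (by norm_num) (by norm_num) 1 (-1) 0 (-3780) 56970 (by decide +kernel)
    (by decide +kernel) (by decide +kernel) 11 13 13 (by norm_num) (by norm_num) (by norm_num) (by norm_num)
    (by norm_num) (by norm_num) (by norm_num) (by norm_num) (by norm_num) (by decide +kernel) (by decide +kernel)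
    (by decide +kernel) (n₁ := 17) (n₂ := 18) (n₃ := 18) (hc₁ := by decide +kernel) (hc₂ := by decide +kernel)
    (hc₃ := by decide +kernel) (by decide +kernel) (by decide +kernel) (by decide +kernel) hGZK W
    (by rw [hW]; norm_num) hKo hB hK hH hP hnt hI hr hq hv

/-- **`BSD(E,7)` for `310590cc1`** (`N = 310590 = 2·3²·5·7·17·29`; NON-SPLIT MULTIPLICATIVE at `7` (Kodaira `I1`, `c_7 = 1`, additive at `3`);
`#tors = 1`, `∏c = 3`, `r_an = 1`, `#Ш_an = 1`, generator `(-2506577/15876, 158563061/2000376)`; lane residue cell `(7, X11b)` (bsdN v4u/v5u of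
record: `residue:X11b`, lane tail T-KOLY); ALSO the unit's GEN 10 beyond-window DATA record in `X11b/BeyondWindowRecords38.lean` (Skinner 2016 Thm.
A ∘ Stein–Wuthrich 2013 `p`-adic road, binders as displayed there) — this row is a SECOND road). `D = -3239` (3239 = 41·79):
**`m = [E(K):ℤy_K] = 36`, `7 ∤ m`** (`ρ = 324.00…`; `L'(E,1) = 8.38362456…`, `L(E^D,1) = 1.96763441…`, `ĥ(x) = 9.68647445…`) — engine 1 (j259809) =
engine 2 (j260660; EQUAL, dev. ≤ 3.1·10⁻¹⁴, checks true); twist `E^D` (j260667): `#tors·∏c·#Ш_an = 1·12·9`, prime to `7` — BSD-consistent. Witnesses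
mod `7` `(ℓ,#Ẽ(𝔽_ℓ))` = `(11,17)` (`a = -5`, `a² − 4ℓ ≡ 2` square), `(43,48)` (`a = -4`, `a² − 4ℓ ≡ 5` non-square), `(13,16)` (`u ≡ 3`).
[cite: McCallumLMS1991, §1 Theorem (Kolyvagin), p. 296] [cite: Serre1972, §2.8 Prop. 19] [cite: Cremona2006, Table 1 (label 310590cc1)] -/
theorem bsdp_k310590cc1_7 (hGZK : rank_eq_analyticRank_of_analyticRank_le_one) (W : WeierstrassCurve ℚ)
    (hW : W = ⟨1, -1, 1, -74993, -7885789⟩) {N : ℕ} [NeZero N] {K : Type} [Field K] [NumberField K]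
    (hKo : kolyvagin N W K) (hB : Kolyvagin1990_padicValNat_card_sha_le N W K) (hK : IsImaginaryQuadratic K)
    (hH : SatisfiesHeegnerHypothesis N K) {P : (W.baseChange K).toAffine.Point} (hP : IsHeegnerPoint N W K P)
    (hnt : ¬ IsOfFinAddOrder P) (hI : ¬ 7 ∣ (AddSubgroup.zmultiples P).index) (hr : W.analyticRank ≤ 1)
    {q : ℚ} (hq : shaAn W = (q : ℂ)) (hv : padicValRat 7 q = 0) : BSDp W 7 :=
  bsdp_prime_of_kolyvaginIndex_of_serreCounts 7 (by norm_num) (by norm_num) 1 (-1) 1 (-74993) (-7885789) (by decide +kernel)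
    (by decide +kernel) (by decide +kernel) 11 43 13 (by norm_num) (by norm_num) (by norm_num) (by norm_num)
    (by norm_num) (by norm_num) (by norm_num) (by norm_num) (by norm_num) (by decide +kernel) (by decide +kernel)
    (by decide +kernel) (n₁ := 17) (n₂ := 48) (n₃ := 16) (hc₁ := by decide +kernel) (hc₂ := by decide +kernel)
    (hc₃ := by decide +kernel) (by decide +kernel) (by decide +kernel) (by decide +kernel) hGZK W
    (by rw [hW]; norm_num) hKo hB hK hH hP hnt hI hr hq hv

end Summit.BirchSwinnertonDyer.Rank1Residual.X11b

end
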